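import Mathlib

/-!
# SoloBlindComplementUnique — the complements of a fixed submodule form a torsor under `Hom(N, Q)`

Solo-blind programme on `Summit.KontsevichZagierPeriods` (Kontsevich–Zagier period conjecture in the
effective Nori form), session s70.  This is the kernel form of the UNIQUENESS STEP in the proof of
PROPOSITION W / W′ (`paper/inj-sectors.md` §12–§13, claims C670, C674): in the weight-by-weight
induction that lifts an `MM`-subobject of a realised effective mixed motive, one meets an
`MM`-complement `N″` of the lowest-weight piece `Φ(Q)` inside `Φ(E₂)` and must know that it IS the
image of the effective complement produced by splitting descent.  The mechanism is linear algebra: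
for a submodule `Q ≤ E` and one complement `N` of `Q`, the complements of `Q` are exactly the
graphs `{n + f n | n ∈ N}` of the linear maps `f : N →ₗ[R] Q`, each complement being the graph of a
unique `f` — a torsor under `Hom(N, Q)` (`N ≃ E ⧸ Q`).  When that Hom-group vanishes (in the
application: `Hom_MM(Φ P̄, Φ Q) = 0` by strictness of weights, the weights of `P̄` exceeding the
weight of `Q`) the complement is unique.

Main results (`R` a ring, `E` an `R`-module, `Q N : Submodule R E`):
* `graphCompl N Q f` — the graph submodule of `f : N →ₗ[R] Q`;
* `isCompl_graphCompl` — over a complement `N` of `Q` every graph is again a complement (action);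
* `eq_graphCompl_complShift` — every complement `N₁` of `Q` is the graph of the explicit map
  `complShift` (transitivity);
* `graphCompl_injective` — distinct maps give distinct complements (freeness);
* `compl_eq_of_forall_hom_eq_zero` — if every linear map `N →ₗ[R] Q` vanishes, every complement of
  `Q` equals `N`; `compl_eq_of_forall_quotient_hom_eq_zero` — the same hypothesis phrased on
  `E ⧸ Q →ₗ[R] Q`.
Complete proofs; no axioms beyond the standard three.
-/

namespace Summit.KontsevichZagierPeriods.KontsevichZagierPeriods.Theorems

open Submodule

universe u v

variable {R : Type u} [Ring R] {E : Type v} [AddCommGroup E] [Module R E]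

/-- The graph of `f : N →ₗ[R] Q` inside `E`: the submodule `{n + f n | n ∈ N}`, realised as the
range of `N.subtype + Q.subtype ∘ f`. -/
def graphCompl (N Q : Submodule R E) (f : N →ₗ[R] Q) : Submodule R E :=
  LinearMap.range (N.subtype + Q.subtype ∘ₗ f)

/-- Membership in the graph submodule: `x ∈ graphCompl N Q f ↔ ∃ n : N, n + f n = x`. -/
theorem mem_graphCompl {N Q : Submodule R E} {f : N →ₗ[R] Q} {x : E} :
    x ∈ graphCompl N Q f ↔ ∃ n : N, (n : E) + (f n : E) = x := by
  simp [graphCompl, LinearMap.mem_range]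

/-- The element `n + f n` lies in the graph of `f`. -/
theorem add_mem_graphCompl {N Q : Submodule R E} (f : N →ₗ[R] Q) (n : N) :
    (n : E) + (f n : E) ∈ graphCompl N Q f :=
  mem_graphCompl.2 ⟨n, rfl⟩

/-- The graph of the zero map is `N` itself. -/
theorem graphCompl_zero (N Q : Submodule R E) : graphCompl N Q (0 : N →ₗ[R] Q) = N := by
  ext x
  rw [mem_graphCompl]
  constructor
  · rintro ⟨n, rfl⟩
    simp
  · intro hx
    exact ⟨⟨x, hx⟩, by simp⟩

/-- ACTION.  If `N` is a complement of `Q`, the graph of any `f : N →ₗ[R] Q` is again a complement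
of `Q`: `Q ⊓ graph = 0` because `n + f n ∈ Q` forces `n ∈ Q ⊓ N = 0`, and `Q + graph = E` because
`q + n = (q - f n) + (n + f n)`. -/
theorem isCompl_graphCompl {Q N : Submodule R E} (h : IsCompl Q N) (f : N →ₗ[R] Q) :
    IsCompl Q (graphCompl N Q f) := by
  constructor
  · rw [Submodule.disjoint_def]
    intro x hxQ hxG
    obtain ⟨n, rfl⟩ := mem_graphCompl.1 hxG
    have hnQ : (n : E) ∈ Q := by
      have : (n : E) = ((n : E) + (f n : E)) - (f n : E) := by abel
      rw [this]
      exact Q.sub_mem hxQ (f n).2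
    have hn0 : (n : E) = 0 := (Submodule.disjoint_def.1 h.disjoint) _ hnQ n.2
    have hn0' : n = 0 := by exact_mod_cast hn0
    simp [hn0']
  · rw [Submodule.codisjoint_iff_exists_add_eq]
    intro z
    obtain ⟨q, n, hq, hn, hqn⟩ := (Submodule.codisjoint_iff_exists_add_eq).1 h.codisjoint z
    refine ⟨q - (f ⟨n, hn⟩ : E), (n : E) + (f ⟨n, hn⟩ : E), Q.sub_mem hq (f ⟨n, hn⟩).2,
      add_mem_graphCompl f ⟨n, hn⟩, ?_⟩
    rw [← hqn]
    abel

/-- The shift map of a second complement: for complements `N₁` and `N` of `Q`, send `n ∈ N` to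
MINUS its `Q`-component along the decomposition `E = Q ⊕ N₁`; then `n + complShift n` is the
`N₁`-component of `n`. -/
noncomputable def complShift {Q N₁ : Submodule R E} (h₁ : IsCompl Q N₁) (N : Submodule R E) :
    N →ₗ[R] Q :=
  -((Q.projectionOnto N₁ h₁) ∘ₗ N.subtype)

/-- Value of the shift map. -/
theorem complShift_apply {Q N₁ : Submodule R E} (h₁ : IsCompl Q N₁) (N : Submodule R E) (n : N) :
    (complShift h₁ N n : E) = -(Q.projection N₁ h₁ (n : E)) := by
  simp [complShift]

/-- TRANSITIVITY.  Every complement `N₁` of `Q` is the graph, over any other complement `N`, of the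
explicit linear map `complShift h₁ N : N →ₗ[R] Q`. -/
theorem eq_graphCompl_complShift {Q N N₁ : Submodule R E} (h : IsCompl Q N) (h₁ : IsCompl Q N₁) :
    N₁ = graphCompl N Q (complShift h₁ N) := by
  ext x
  rw [mem_graphCompl]
  constructor
  · intro hx
    -- decompose `x = q + n` along `E = Q ⊕ N`
    obtain ⟨q, n, hq, hn, hqn⟩ := (Submodule.codisjoint_iff_exists_add_eq).1 h.codisjoint x
    refine ⟨⟨n, hn⟩, ?_⟩
    -- the `Q`-component of `n = x - q` along `Q ⊕ N₁` is `-q`, since `x ∈ N₁`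
    have hproj : Q.projection N₁ h₁ n = -q := by
      have hnq : n = x - q := by rw [← hqn]; abel
      rw [hnq, map_sub, (Submodule.projection_apply_eq_zero_iff h₁).2 hx,
        Submodule.projection_apply_of_mem_left h₁ hq, zero_sub]
    simp only [complShift_apply, hproj, neg_neg]
    rw [add_comm, hqn]
  · rintro ⟨n, rfl⟩
    rw [complShift_apply, ← sub_eq_add_neg]
    exact Submodule.sub_projection_mem h₁ (n : E)

/-- FREENESS.  Distinct linear maps have distinct graphs (over a complement `N` of `Q`). -/
theorem graphCompl_injective {Q N : Submodule R E} (h : IsCompl Q N) :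
    Function.Injective (graphCompl N Q : (N →ₗ[R] Q) → Submodule R E) := by
  intro f g hfg
  ext n
  have hmem : (n : E) + (f n : E) ∈ graphCompl N Q g := by
    rw [← hfg]; exact add_mem_graphCompl f n
  obtain ⟨n', hn'⟩ := mem_graphCompl.1 hmem
  -- `n' + g n' = n + f n` ⟹ `n' - n = f n - g n' ∈ Q ⊓ N = 0`
  have hQ : (n' : E) - (n : E) ∈ Q := by
    have hdiff : (n' : E) - (n : E) = (f n : E) - (g n' : E) := by
      rw [eq_sub_of_add_eq hn']; abel
    rw [hdiff]; exact Q.sub_mem (f n).2 (g n').2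
  have hN : (n' : E) - (n : E) ∈ N := N.sub_mem n'.2 n.2
  have h0 : (n' : E) - (n : E) = 0 := (Submodule.disjoint_def.1 h.disjoint) _ hQ hN
  have hn'eq : n' = n := by ext; exact sub_eq_zero.1 h0
  subst hn'eq
  have h2 : (g n' : E) = (f n' : E) := add_left_cancel hn'
  exact h2.symm

/-- UNIQUENESS (the step used in PROPOSITION W).  If every linear map from a complement `N` of `Q`
to `Q` vanishes, then every complement of `Q` equals `N`. -/
theorem compl_eq_of_forall_hom_eq_zero {Q N N₁ : Submodule R E} (h : IsCompl Q N)
    (h₁ : IsCompl Q N₁) (hom0 : ∀ f : N →ₗ[R] Q, f = 0) : N₁ = N := by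
  rw [eq_graphCompl_complShift h h₁, hom0 (complShift h₁ N), graphCompl_zero]

/-- UNIQUENESS, quotient phrasing.  If every linear map `E ⧸ Q →ₗ[R] Q` vanishes, any two complements
of `Q` coincide (a complement `N` of `Q` is isomorphic to `E ⧸ Q`). -/
theorem compl_eq_of_forall_quotient_hom_eq_zero {Q N N₁ : Submodule R E} (h : IsCompl Q N)
    (h₁ : IsCompl Q N₁) (hom0 : ∀ f : (E ⧸ Q) →ₗ[R] Q, f = 0) : N₁ = N := by
  refine compl_eq_of_forall_hom_eq_zero h h₁ fun f => ?_
  -- transport `f` to the quotient through `E ⧸ Q ≃ N`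
  have hf : f ∘ₗ (Submodule.quotientEquivOfIsCompl Q N h : (E ⧸ Q) →ₗ[R] N) = 0 := hom0 _
  ext n
  have := LinearMap.congr_fun hf ((Submodule.quotientEquivOfIsCompl Q N h).symm n)
  simpa using this

/-- TORSOR SUMMARY.  Over a complement `N` of `Q`, `f ↦ graphCompl N Q f` is a bijection from
`N →ₗ[R] Q` onto the set of complements of `Q`. -/
theorem graphCompl_bijective_onto_complements {Q N : Submodule R E} (h : IsCompl Q N) :
    Function.Bijective
      (fun f : N →ₗ[R] Q => (⟨graphCompl N Q f, isCompl_graphCompl h f⟩ : {N₁ // IsCompl Q N₁})) := by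
  constructor
  · intro f g hfg
    exact graphCompl_injective h (congrArg Subtype.val hfg)
  · rintro ⟨N₁, h₁⟩
    exact ⟨complShift h₁ N, Subtype.ext (eq_graphCompl_complShift h h₁).symm⟩

end Summit.KontsevichZagierPeriods.KontsevichZagierPeriods.Theorems
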